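import Literature.NumberTheory.LFunctions.DirichletPolynomialCrudeMVT
import Literature.NumberTheory.LFunctions.MertensSecondExpSqrt
import Literature.NumberTheory.LFunctions.SelbergFujiiMoments
import HarnessLib

/-!
# Selberg–Fujii: mean values of the prime polynomial `∑_{p ≤ N} p^{-1/2}(p^{-ih} − 1) p^{-it}` — proofs

Trunk T-ANT (`Literature/NumberTheory/LFunctions`). Proofs only (no definitions, no named facts).
Sixth file of the Selberg–Fujii cluster (`ZeroGaps.lean`, `ZeroGapsProofs.lean`,
`SelbergFujiiLargeGaps.lean`, `SelbergFujiiMoments.lean`, `SelbergFujiiSmallGaps.lean`,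
`SelbergFujiiGapMoment.lean`). After `SelbergFujiiGapMoment.lean` both named facts
`Literature.NumberTheory.LFunctions.selberg_fujii_large_gaps` / `…small_gaps` rest on two
one-sided moment bounds for `S(t + h) − S(t)` (`hS`: an `L¹` lower bound at one scale
`h ≍ M/log T` on `[T, 2T]`; `h2`: the mean-square upper bound `≪ T log(3 + h log T)`). Both
follow from Selberg's mean-value approximate formula
`∫_{T/2}^{T} |S(t) + π⁻¹ ∑_{p ≤ y} sin(t log p)/√p|² dt = O(T)` (Titchmarsh Thm. 14.22, there
on RH; unconditionally Selberg 1946) once the prime polynomial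
`P(t + h) − P(t) = −Im ∑_{p ≤ N} b_p p^{-it}`, `b_p = p^{-1/2}(p^{-ih} − 1)`, is controlled in
`L¹` from below and in `L²` from above. This file PROVES that control; the deduction of `hS`,
`h2` and of the two gap facts from the approximate formula is the next file of the cluster.

## Main results (all PROVED; `Q(t) = ∑_{p ≤ N} b_p p^{-it}` for arbitrary `b`)

* `SelbergFujii.abs_integral_norm_sq_primeSum_sub_le` —
  `|∫_T^{2T} |Q|² − T ∑|b_p|²| ≤ 8N(1 + log N) ∑|b_p|²` (the tree's crude mean value theorem
  `DirichletMVT.abs_meanSquare_sub_le`, at `2T` and `T`).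
* `SelbergFujii.norm_integral_primeSum_sq_le` — `‖∫_T^{2T} Q²‖ ≤ 3N ∑|b_p|²` (no constant term:
  `pq ≥ 4`).
* `SelbergFujii.integral_norm_primeSum_pow_four_le` —
  `∫_T^{2T} |Q|⁴ ≤ (T + 8N²(1 + log N²)) · 2(∑|b_p|²)²` (`Q²` is a Dirichlet polynomial on
  `[1, N²]` whose coefficients `c_n = ∑_{pq=n} b_p b_q` have `∑|c_n|² ≤ 2(∑|b_p|²)²`, each `n`
  having at most two representations — `card_filter_mul_eq_le_two`).
* `SelbergFujii.le_integral_abs_im_primeSum` — the `L¹` LOWER bound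
  `∫_T^{2T} |Im Q| ≥ (3/128) T (∑|b_p|²)^{1/2}` for `T ≥ 16N(1 + log N) + 6N + 8N²(1 + log N²)`
  (`(Im Q)² = (|Q|² − Re Q²)/2`, the three bounds above, and `|x| ≥ x²/K − x⁴/K³` with
  `K = 8 (∑|b_p|²)^{1/2}`, `SelbergFujii.sq_div_sub_pow_four_div_le_abs`).
* `SelbergFujii.im_primeSum_coeff`, `…sum_norm_sq_coeff` — for `b_p = p^{-1/2}(p^{-ih} − 1)`:
  `Im Q(t) = −∑_{p ≤ N} (sin((t+h) log p) − sin(t log p))/√p` and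
  `∑ |b_p|² = V(h, N) := ∑_{p ≤ N} 2(1 − cos(h log p))/p`.
* `SelbergFujii.variance_le` — `V(h, N) ≤ 4 log(2 + h log N) + 70` (`0 ≤ h ≤ 1`, `N ≥ 2`):
  `1 − cos u ≤ u²/2` below `e^{1/h}` with Mertens' first theorem, `≤ 2` above it with Mertens'
  second theorem (error `8/log`, `Mertens.abs_primeRecipSum_sub_le`).
* `SelbergFujii.variance_ge` — for every `V₀` there is `L₀` with `V(h, N) ≥ V₀` whenever
  `0 < h ≤ 1`, `h log N ≥ L₀`: on the window `2πk + 2π/3 ≤ h log p ≤ 2πk + 4π/3`,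
  `cos(h log p) ≤ −1/2`, and Mertens' second theorem with error `K/log²`
  (`Mertens.abs_primeRecipSum_sub_loglog_sub_le 2`) makes the `k`-th window contribute
  `≥ 1/(k+1) − K/(6k²)` (`window_lower_bound`); `∑_{k ≤ M} 1/(k+1) ≥ log(M+2) − log 2`, `∑ 1/k² ≤ 2`.

## References

* E. C. Titchmarsh, *The Theory of the Riemann Zeta-Function*, 2nd ed. revised by
  D. R. Heath-Brown (1986): §7.2 (mean values of Dirichlet polynomials), §§14.22–14.23 (the
  prime polynomial `∑_{p<x²} sin(t log p)/√p`, its mean square `¼ T log log T + O(T)` via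
  `∑ 1/p = log log + O(1)` and `∫ (pq)^{±it} = O(1)`), §9.26. [key `Titchmarsh1986`]
* H. L. Montgomery, R. C. Vaughan, *Multiplicative Number Theory I* (2007), Thm 2.7 (d)
  (Mertens' second theorem with the prime number theorem error term). [MontgomeryVaughan2007]
* G. H. Hardy, E. M. Wright, *An Introduction to the Theory of Numbers*, Thms 425, 427.
  [HardyWright2008]
* A. Selberg, *Contributions to the theory of the Riemann zeta-function*, Arch. Math. Naturvid.
  48 (1946), no. 5, 89–155.
-/

noncomputable section

open Real MeasureTheory Set Filter Complex
open scoped ComplexConjugate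

namespace Literature.NumberTheory.LFunctions

namespace SelbergFujii

/-! ### Prime Dirichlet polynomials `∑_{p ≤ N} b_p p^{-it}` -/

/-- A prime polynomial is a Dirichlet polynomial on `[1, N]` whose coefficients vanish off the
primes. [folklore] -/
theorem sum_primesLE_eq_sum_Icc_ite (N : ℕ) (f : ℕ → ℂ) :
    ∑ p ∈ Nat.primesLE N, f p = ∑ n ∈ Finset.Icc 1 N, if n.Prime then f n else 0 := by
  rw [← Finset.sum_filter]
  congr 1
  ext n
  simp only [Nat.mem_primesLE, Finset.mem_filter, Finset.mem_Icc]
  exact ⟨fun ⟨h1, h2⟩ ↦ ⟨⟨h2.one_le, h1⟩, h2⟩, fun ⟨⟨_, h1⟩, h2⟩ ↦ ⟨h1, h2⟩⟩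

/-- Continuity in `t` of a prime polynomial. [folklore] -/
theorem continuous_primeSum (N : ℕ) (b : ℕ → ℂ) :
    Continuous fun t : ℝ ↦ ∑ p ∈ Nat.primesLE N, b p * (p : ℂ) ^ (-((t : ℂ) * I)) := by
  refine continuous_finsetSum _ fun p hp ↦ ?_
  have hp0 : p ≠ 0 := (Nat.mem_primesLE.1 hp).2.ne_zero
  simp_rw [natCast_cpow_neg_mul_I hp0]
  fun_prop

/-- Continuity in `t` of a Dirichlet polynomial on `[1, N]`. [folklore] -/
theorem continuous_dirichletSum (N : ℕ) (a : ℕ → ℂ) :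
    Continuous fun t : ℝ ↦ ∑ n ∈ Finset.Icc 1 N, a n * (n : ℂ) ^ (-((t : ℂ) * I)) := by
  refine continuous_finsetSum _ fun n hn ↦ ?_
  have hn0 : n ≠ 0 := by rw [Finset.mem_Icc] at hn; omega
  simp_rw [natCast_cpow_neg_mul_I hn0]
  fun_prop

/-- **Mean square of a Dirichlet polynomial on `[T, 2T]`, two-sided** (the crude mean value
theorem `DirichletMVT.abs_meanSquare_sub_le` at `2T` and at `T`):
`|∫_T^{2T} |∑_{n ≤ N} a_n n^{-it}|² dt − T ∑ |a_n|²| ≤ 8N(1 + log N) ∑ |a_n|²`.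
[cite: Titchmarsh1986, §7.2] -/
theorem abs_integral_norm_sq_dirichletSum_sub_le (a : ℕ → ℂ) (N : ℕ) (T : ℝ) :
    |(∫ t in T..2 * T, ‖∑ n ∈ Finset.Icc 1 N, a n * (n : ℂ) ^ (-((t : ℂ) * I))‖ ^ 2) -
        T * ∑ n ∈ Finset.Icc 1 N, ‖a n‖ ^ 2| ≤
      8 * N * (1 + Real.log N) * ∑ n ∈ Finset.Icc 1 N, ‖a n‖ ^ 2 := by
  have h2 := DirichletMVT.abs_meanSquare_sub_le a N (2 * T)
  have h1 := DirichletMVT.abs_meanSquare_sub_le a N T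
  have hcont : Continuous fun t : ℝ ↦
      ‖∑ n ∈ Finset.Icc 1 N, a n * (n : ℂ) ^ (-((t : ℂ) * I))‖ ^ 2 :=
    (continuous_norm.comp (continuous_dirichletSum N a)).pow 2
  have hadd := intervalIntegral.integral_add_adjacent_intervals
    (hcont.intervalIntegrable (μ := volume) 0 T) (hcont.intervalIntegrable (μ := volume) T (2 * T))
  rw [abs_le] at h1 h2 ⊢
  constructor <;> nlinarith [h1.1, h1.2, h2.1, h2.2, hadd]

/-- **Mean square of a prime polynomial on `[T, 2T]`, two-sided**:
`|∫_T^{2T} |∑_{p ≤ N} b_p p^{-it}|² dt − T ∑ |b_p|²| ≤ 8N(1 + log N) ∑ |b_p|²`.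
[cite: Titchmarsh1986, §7.2] -/
theorem abs_integral_norm_sq_primeSum_sub_le (N : ℕ) (b : ℕ → ℂ) (T : ℝ) :
    |(∫ t in T..2 * T, ‖∑ p ∈ Nat.primesLE N, b p * (p : ℂ) ^ (-((t : ℂ) * I))‖ ^ 2) -
        T * ∑ p ∈ Nat.primesLE N, ‖b p‖ ^ 2| ≤
      8 * N * (1 + Real.log N) * ∑ p ∈ Nat.primesLE N, ‖b p‖ ^ 2 := by
  set a : ℕ → ℂ := fun n ↦ if n.Prime then b n else 0 with ha
  have hsum : ∀ t : ℝ, ∑ p ∈ Nat.primesLE N, b p * (p : ℂ) ^ (-((t : ℂ) * I)) =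
      ∑ n ∈ Finset.Icc 1 N, a n * (n : ℂ) ^ (-((t : ℂ) * I)) := by
    intro t
    rw [sum_primesLE_eq_sum_Icc_ite]
    refine Finset.sum_congr rfl fun n _ ↦ ?_
    by_cases h : n.Prime <;> simp [ha, h]
  have hnorm : ∑ p ∈ Nat.primesLE N, ‖b p‖ ^ 2 = ∑ n ∈ Finset.Icc 1 N, ‖a n‖ ^ 2 := by
    have := sum_primesLE_eq_sum_Icc_ite N (fun n ↦ ((‖b n‖ ^ 2 : ℝ) : ℂ))
    have e : ∀ n : ℕ, (if n.Prime then ((‖b n‖ ^ 2 : ℝ) : ℂ) else 0) = ((‖a n‖ ^ 2 : ℝ) : ℂ) := by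
      intro n
      by_cases h : n.Prime <;> simp [ha, h]
    simp_rw [e] at this
    exact_mod_cast this
  simp_rw [hsum, hnorm]
  exact abs_integral_norm_sq_dirichletSum_sub_le a N T

/-- `∫_T^{2T} p^{-it} q^{-it} dt` is bounded: `‖∫_T^{2T} e^{-it(log p + log q)} dt‖ ≤ 3` for
`p, q ≥ 2` (as `log p + log q ≥ 2 log 2 > 4/3`). [cite: Titchmarsh1986, §7.2] -/
theorem norm_integral_exp_neg_mul_log_mul_le {p q : ℕ} (hp : 2 ≤ p) (hq : 2 ≤ q) (T : ℝ) :
    ‖∫ t in T..2 * T, cexp ((-(t * (Real.log p + Real.log q)) : ℝ) * I)‖ ≤ 3 := by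
  set L : ℝ := -(Real.log p + Real.log q) with hL
  have hl2 := Real.log_two_gt_d9
  have hlp : Real.log 2 ≤ Real.log p := Real.log_le_log two_pos (by exact_mod_cast hp)
  have hlq : Real.log 2 ≤ Real.log q := Real.log_le_log two_pos (by exact_mod_cast hq)
  have hLabs : 4 / 3 ≤ |L| := by
    rw [hL, abs_neg, abs_of_nonneg (by linarith)]; linarith
  have hL0 : L ≠ 0 := fun h ↦ by rw [h, abs_zero] at hLabs; linarith
  have hcont : Continuous fun t : ℝ ↦ cexp (((t * L : ℝ) : ℂ) * I) := by fun_prop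
  have e : ∀ t : ℝ, cexp ((-(t * (Real.log p + Real.log q)) : ℝ) * I) = cexp (((t * L : ℝ) : ℂ) * I) := by
    intro t; rw [hL]; congr 2; push_cast; ring
  simp_rw [e]
  rw [← intervalIntegral.integral_interval_sub_left (hcont.intervalIntegrable 0 (2 * T))
    (hcont.intervalIntegrable 0 T)]
  have h1 := DirichletMVT.norm_integral_exp_mul_I_le hL0 (2 * T)
  have h2 := DirichletMVT.norm_integral_exp_mul_I_le hL0 T
  have h3 : 2 / |L| ≤ 3 / 2 := by
    rw [div_le_iff₀ (by linarith)]; linarith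
  linarith [norm_sub_le (∫ t in (0 : ℝ)..2 * T, cexp (((t * L : ℝ) : ℂ) * I))
    (∫ t in (0 : ℝ)..T, cexp (((t * L : ℝ) : ℂ) * I))]

/-- **The square of a prime polynomial has no constant term**:
`‖∫_T^{2T} (∑_{p ≤ N} b_p p^{-it})² dt‖ ≤ 3 N ∑ |b_p|²` (expand, `‖∫ (pq)^{-it}‖ ≤ 3`,
Cauchy–Schwarz `(∑ |b_p|)² ≤ N ∑ |b_p|²`). [cite: Titchmarsh1986, §14.23] -/
theorem norm_integral_primeSum_sq_le (N : ℕ) (b : ℕ → ℂ) (T : ℝ) :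
    ‖∫ t in T..2 * T, (∑ p ∈ Nat.primesLE N, b p * (p : ℂ) ^ (-((t : ℂ) * I))) ^ 2‖ ≤
      3 * N * ∑ p ∈ Nat.primesLE N, ‖b p‖ ^ 2 := by
  set P := Nat.primesLE N with hP
  have hP2 : ∀ p ∈ P, 2 ≤ p := fun p hp ↦ (Nat.mem_primesLE.1 hp).2.two_le
  have hP0 : ∀ p ∈ P, p ≠ 0 := fun p hp ↦ (Nat.mem_primesLE.1 hp).2.ne_zero
  -- expand the square
  set e : ℕ → ℕ → ℝ → ℂ := fun p q t ↦ cexp ((-(t * (Real.log p + Real.log q)) : ℝ) * I) with he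
  have hexp : ∀ t : ℝ, (∑ p ∈ P, b p * (p : ℂ) ^ (-((t : ℂ) * I))) ^ 2 =
      ∑ p ∈ P, ∑ q ∈ P, b p * b q * e p q t := by
    intro t
    rw [sq, Finset.sum_mul_sum]
    refine Finset.sum_congr rfl fun p hp ↦ Finset.sum_congr rfl fun q hq ↦ ?_
    rw [natCast_cpow_neg_mul_I (hP0 p hp), natCast_cpow_neg_mul_I (hP0 q hq), he]
    simp only
    rw [mul_mul_mul_comm, ← Complex.exp_add]
    congr 2; push_cast; ring
  simp_rw [hexp]
  have hcont : ∀ p q, Continuous (e p q) := fun p q ↦ by simp only [he]; fun_prop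
  have hint : ∀ p q, IntervalIntegrable (fun t ↦ b p * b q * e p q t) volume T (2 * T) :=
    fun p q ↦ ((hcont p q).const_mul _).intervalIntegrable _ _
  rw [intervalIntegral.integral_finsetSum fun p _ ↦
    (continuous_finsetSum _ fun q _ ↦ (hcont p q).const_mul _).intervalIntegrable _ _]
  simp_rw [intervalIntegral.integral_finsetSum fun q _ ↦ hint _ q,
    intervalIntegral.integral_const_mul]
  -- bound term by term
  calc ‖∑ p ∈ P, ∑ q ∈ P, b p * b q * ∫ t in T..2 * T, e p q t‖
      ≤ ∑ p ∈ P, ‖∑ q ∈ P, b p * b q * ∫ t in T..2 * T, e p q t‖ := norm_sum_le _ _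
    _ ≤ ∑ p ∈ P, ∑ q ∈ P, ‖b p‖ * ‖b q‖ * 3 := by
        refine Finset.sum_le_sum fun p hp ↦ (norm_sum_le _ _).trans (Finset.sum_le_sum fun q hq ↦ ?_)
        rw [norm_mul, norm_mul]
        exact mul_le_mul_of_nonneg_left (norm_integral_exp_neg_mul_log_mul_le (hP2 p hp) (hP2 q hq) T)
          (by positivity)
    _ = 3 * (∑ p ∈ P, ‖b p‖) ^ 2 := by
        rw [sq, Finset.sum_mul_sum, Finset.mul_sum]
        refine Finset.sum_congr rfl fun p _ ↦ ?_
        rw [Finset.mul_sum]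
        refine Finset.sum_congr rfl fun q _ ↦ ?_
        ring
    _ ≤ 3 * (P.card * ∑ p ∈ P, ‖b p‖ ^ 2) :=
        mul_le_mul_of_nonneg_left (sq_sum_le_card_mul_sum_sq (s := P) (f := fun p ↦ ‖b p‖))
          (by norm_num)
    _ ≤ 3 * (N * ∑ p ∈ P, ‖b p‖ ^ 2) := by
        have hc' : P.card ≤ N :=
          calc P.card ≤ (Finset.Icc 1 N).card := Finset.card_le_card fun p hp ↦ by
                  rw [hP, Nat.mem_primesLE] at hp
                  exact Finset.mem_Icc.2 ⟨hp.2.one_le, hp.1⟩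
            _ = N := by simp
        have hc : (P.card : ℝ) ≤ N := by exact_mod_cast hc'
        exact mul_le_mul_of_nonneg_left (mul_le_mul_of_nonneg_right hc
          (Finset.sum_nonneg fun p _ ↦ sq_nonneg _)) (by norm_num)
    _ = 3 * N * ∑ p ∈ P, ‖b p‖ ^ 2 := by ring

/-! ### The fourth moment: squaring a prime polynomial -/

/-- The fibre of `(p, q) ↦ pq` over `n` in `{primes ≤ N}²` has at most two elements (unique
factorisation). [folklore] -/
theorem card_filter_mul_eq_le_two (N n : ℕ) :
    ((Nat.primesLE N ×ˢ Nat.primesLE N).filter (fun x : ℕ × ℕ ↦ x.1 * x.2 = n)).card ≤ 2 := by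
  set F := (Nat.primesLE N ×ˢ Nat.primesLE N).filter (fun x : ℕ × ℕ ↦ x.1 * x.2 = n) with hF
  rcases F.eq_empty_or_nonempty with h | ⟨x₀, hx₀⟩
  · rw [h]; simp
  · have hx₀' := hx₀
    rw [hF, Finset.mem_filter, Finset.mem_product, Nat.mem_primesLE, Nat.mem_primesLE] at hx₀'
    obtain ⟨⟨⟨-, hp₀⟩, -, hq₀⟩, hx₀n⟩ := hx₀'
    have hsub : F ⊆ {x₀, x₀.swap} := by
      intro x hx
      rw [hF, Finset.mem_filter, Finset.mem_product, Nat.mem_primesLE, Nat.mem_primesLE] at hx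
      obtain ⟨⟨⟨-, hp⟩, -, -⟩, hxn⟩ := hx
      have hdvd : x.1 ∣ x₀.1 * x₀.2 := by rw [hx₀n, ← hxn]; exact Dvd.intro _ rfl
      rw [Finset.mem_insert, Finset.mem_singleton]
      rcases (Nat.Prime.dvd_mul hp).1 hdvd with h1 | h1
      · have e1 : x.1 = x₀.1 := (Nat.prime_dvd_prime_iff_eq hp hp₀).1 h1
        left
        have e2 : x.2 = x₀.2 := by
          have : x.1 * x.2 = x.1 * x₀.2 := by rw [hxn, ← hx₀n, e1]
          exact Nat.eq_of_mul_eq_mul_left hp.pos this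
        exact Prod.ext e1 e2
      · have e1 : x.1 = x₀.2 := (Nat.prime_dvd_prime_iff_eq hp hq₀).1 h1
        right
        have e2 : x.2 = x₀.1 := by
          have : x.1 * x.2 = x.1 * x₀.1 := by rw [hxn, ← hx₀n, e1, mul_comm]
          exact Nat.eq_of_mul_eq_mul_left hp.pos this
        exact Prod.ext e1 e2
    exact (Finset.card_le_card hsub).trans Finset.card_le_two

/-- `pq ∈ [1, N²]` for primes `p, q ≤ N`. [folklore] -/
theorem mul_mem_Icc_of_mem_product {N : ℕ} {x : ℕ × ℕ}
    (hx : x ∈ Nat.primesLE N ×ˢ Nat.primesLE N) : x.1 * x.2 ∈ Finset.Icc 1 (N ^ 2) := by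
  rw [Finset.mem_product, Nat.mem_primesLE, Nat.mem_primesLE] at hx
  rw [Finset.mem_Icc]
  refine ⟨Nat.one_le_iff_ne_zero.2 (mul_ne_zero hx.1.2.ne_zero hx.2.2.ne_zero), ?_⟩
  rw [sq]; exact Nat.mul_le_mul hx.1.1 hx.2.1

/-- The coefficients `c_n = ∑_{pq = n} b_p b_q` of the square satisfy
`∑_n |c_n|² ≤ 2 (∑_p |b_p|²)²` (each `n` has at most two representations). [folklore] -/
theorem sum_norm_sq_conv_le (N : ℕ) (b : ℕ → ℂ) :
    ∑ n ∈ Finset.Icc 1 (N ^ 2),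
        ‖∑ x ∈ (Nat.primesLE N ×ˢ Nat.primesLE N).filter (fun x : ℕ × ℕ ↦ x.1 * x.2 = n),
            b x.1 * b x.2‖ ^ 2 ≤
      2 * (∑ p ∈ Nat.primesLE N, ‖b p‖ ^ 2) ^ 2 := by
  set P := Nat.primesLE N with hP
  have hmaps : ∀ x ∈ P ×ˢ P, x.1 * x.2 ∈ Finset.Icc 1 (N ^ 2) := fun x hx ↦
    mul_mem_Icc_of_mem_product hx
  calc ∑ n ∈ Finset.Icc 1 (N ^ 2),
        ‖∑ x ∈ (P ×ˢ P).filter (fun x : ℕ × ℕ ↦ x.1 * x.2 = n), b x.1 * b x.2‖ ^ 2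
      ≤ ∑ n ∈ Finset.Icc 1 (N ^ 2),
          2 * ∑ x ∈ (P ×ˢ P).filter (fun x : ℕ × ℕ ↦ x.1 * x.2 = n), ‖b x.1 * b x.2‖ ^ 2 := by
        refine Finset.sum_le_sum fun n _ ↦ ?_
        calc ‖∑ x ∈ (P ×ˢ P).filter (fun x : ℕ × ℕ ↦ x.1 * x.2 = n), b x.1 * b x.2‖ ^ 2
            ≤ (∑ x ∈ (P ×ˢ P).filter (fun x : ℕ × ℕ ↦ x.1 * x.2 = n), ‖b x.1 * b x.2‖) ^ 2 :=
              pow_le_pow_left₀ (norm_nonneg _) (norm_sum_le _ _) 2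
          _ ≤ ((P ×ˢ P).filter (fun x : ℕ × ℕ ↦ x.1 * x.2 = n)).card *
                ∑ x ∈ (P ×ˢ P).filter (fun x : ℕ × ℕ ↦ x.1 * x.2 = n), ‖b x.1 * b x.2‖ ^ 2 :=
              sq_sum_le_card_mul_sum_sq
          _ ≤ 2 * ∑ x ∈ (P ×ˢ P).filter (fun x : ℕ × ℕ ↦ x.1 * x.2 = n), ‖b x.1 * b x.2‖ ^ 2 := by
              refine mul_le_mul_of_nonneg_right ?_ (Finset.sum_nonneg fun x _ ↦ sq_nonneg _)
              exact_mod_cast card_filter_mul_eq_le_two N n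
    _ = 2 * ∑ x ∈ P ×ˢ P, ‖b x.1 * b x.2‖ ^ 2 := by
        rw [← Finset.mul_sum, Finset.sum_fiberwise_of_maps_to hmaps]
    _ = 2 * (∑ p ∈ P, ‖b p‖ ^ 2) ^ 2 := by
        congr 1
        rw [Finset.sum_product' P P (fun p q ↦ ‖b p * b q‖ ^ 2), sq, Finset.sum_mul_sum]
        refine Finset.sum_congr rfl fun p _ ↦ Finset.sum_congr rfl fun q _ ↦ ?_
        rw [norm_mul, mul_pow]

/-- The square of a prime polynomial is a Dirichlet polynomial on `[1, N²]` with coefficients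
`c_n = ∑_{pq = n} b_p b_q`. [folklore] -/
theorem primeSum_sq_eq (N : ℕ) (b : ℕ → ℂ) (t : ℝ) :
    (∑ p ∈ Nat.primesLE N, b p * (p : ℂ) ^ (-((t : ℂ) * I))) ^ 2 =
      ∑ n ∈ Finset.Icc 1 (N ^ 2),
        (∑ x ∈ (Nat.primesLE N ×ˢ Nat.primesLE N).filter (fun x : ℕ × ℕ ↦ x.1 * x.2 = n),
            b x.1 * b x.2) * (n : ℂ) ^ (-((t : ℂ) * I)) := by
  set P := Nat.primesLE N with hP
  have hmaps : ∀ x ∈ P ×ˢ P, x.1 * x.2 ∈ Finset.Icc 1 (N ^ 2) := fun x hx ↦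
    mul_mem_Icc_of_mem_product hx
  rw [sq, Finset.sum_mul_sum,
    ← Finset.sum_product' P P (fun p q ↦ b p * (p : ℂ) ^ (-((t : ℂ) * I)) *
      (b q * (q : ℂ) ^ (-((t : ℂ) * I)))),
    ← Finset.sum_fiberwise_of_maps_to hmaps]
  refine Finset.sum_congr rfl fun n _ ↦ ?_
  rw [Finset.sum_mul]
  refine Finset.sum_congr rfl fun x hx ↦ ?_
  rw [Finset.mem_filter] at hx
  rw [← hx.2, Nat.cast_mul, Complex.natCast_mul_natCast_cpow]
  ring

/-- **Fourth moment of a prime polynomial on `[T, 2T]`**: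
`∫_T^{2T} |∑_{p ≤ N} b_p p^{-it}|⁴ dt ≤ (T + 8N²(1 + log N²)) · 2 (∑ |b_p|²)²` (square the
polynomial, `sum_norm_sq_conv_le`, and the mean value theorem on `[1, N²]`).
[cite: Titchmarsh1986, §7.2] -/
theorem integral_norm_primeSum_pow_four_le (N : ℕ) (b : ℕ → ℂ) {T : ℝ} (hT : 0 ≤ T) :
    ∫ t in T..2 * T, ‖∑ p ∈ Nat.primesLE N, b p * (p : ℂ) ^ (-((t : ℂ) * I))‖ ^ 4 ≤
      (T + 8 * N ^ 2 * (1 + Real.log (N ^ 2))) *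
        (2 * (∑ p ∈ Nat.primesLE N, ‖b p‖ ^ 2) ^ 2) := by
  set c : ℕ → ℂ := fun n ↦
    ∑ x ∈ (Nat.primesLE N ×ˢ Nat.primesLE N).filter (fun x : ℕ × ℕ ↦ x.1 * x.2 = n),
      b x.1 * b x.2 with hc
  have h4 : ∀ t : ℝ, ‖∑ p ∈ Nat.primesLE N, b p * (p : ℂ) ^ (-((t : ℂ) * I))‖ ^ 4 =
      ‖∑ n ∈ Finset.Icc 1 (N ^ 2), c n * (n : ℂ) ^ (-((t : ℂ) * I))‖ ^ 2 := by
    intro t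
    rw [show (4 : ℕ) = 2 * 2 from rfl, pow_mul, ← norm_pow, primeSum_sq_eq]
  simp_rw [h4]
  have hmvt := abs_integral_norm_sq_dirichletSum_sub_le c (N ^ 2) T
  have hcoef : ∑ n ∈ Finset.Icc 1 (N ^ 2), ‖c n‖ ^ 2 ≤
      2 * (∑ p ∈ Nat.primesLE N, ‖b p‖ ^ 2) ^ 2 := sum_norm_sq_conv_le N b
  have h0 : 0 ≤ ∑ n ∈ Finset.Icc 1 (N ^ 2), ‖c n‖ ^ 2 := Finset.sum_nonneg fun n _ ↦ sq_nonneg _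
  push_cast at hmvt
  have hlog : 0 ≤ 1 + Real.log ((N : ℝ) ^ 2) := by
    rcases Nat.eq_zero_or_pos N with hN | hN
    · rw [hN]; simp
    · have : (1 : ℝ) ≤ (N : ℝ) ^ 2 := one_le_pow₀ (by exact_mod_cast hN)
      linarith [Real.log_nonneg this]
  have hE : 0 ≤ T + 8 * (N : ℝ) ^ 2 * (1 + Real.log ((N : ℝ) ^ 2)) := by positivity
  rw [abs_le] at hmvt
  calc ∫ t in T..2 * T, ‖∑ n ∈ Finset.Icc 1 (N ^ 2), c n * (n : ℂ) ^ (-((t : ℂ) * I))‖ ^ 2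
      ≤ (T + 8 * (N : ℝ) ^ 2 * (1 + Real.log ((N : ℝ) ^ 2))) *
          ∑ n ∈ Finset.Icc 1 (N ^ 2), ‖c n‖ ^ 2 := by linarith [hmvt.2]
    _ ≤ _ := mul_le_mul_of_nonneg_left hcoef hE

/-! ### The first absolute moment of the imaginary part from below -/

/-- **`L¹` lower bound for the imaginary part of a prime polynomial**: for
`T ≥ 16N(1 + log N) + 6N + 8N²(1 + log N²)`,
`∫_T^{2T} |Im ∑_{p ≤ N} b_p p^{-it}| dt ≥ (3/128) T (∑ |b_p|²)^{1/2}`.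
Proof: `(Im Q)² = (|Q|² − Re Q²)/2`, so `∫ (Im Q)² ≥ TV/4` by the mean square
(`abs_integral_norm_sq_primeSum_sub_le`) and `‖∫ Q²‖ ≤ 3NV` (`norm_integral_primeSum_sq_le`);
`∫ (Im Q)⁴ ≤ ∫ |Q|⁴ ≤ 4TV²` (`integral_norm_primeSum_pow_four_le`); and
`|x| ≥ x²/K − x⁴/K³` with `K = 8V^{1/2}` (`sq_div_sub_pow_four_div_le_abs`).
[cite: Titchmarsh1986, §9.26 (Hölder step), §14.23] -/
theorem le_integral_abs_im_primeSum (N : ℕ) (b : ℕ → ℂ) {T : ℝ} (hT : 0 ≤ T)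
    (hN : 16 * N * (1 + Real.log N) + 6 * N + 8 * N ^ 2 * (1 + Real.log (N ^ 2)) ≤ T) :
    3 / 128 * T * Real.sqrt (∑ p ∈ Nat.primesLE N, ‖b p‖ ^ 2) ≤
      ∫ t in T..2 * T, |(∑ p ∈ Nat.primesLE N, b p * (p : ℂ) ^ (-((t : ℂ) * I))).im| := by
  set P := Nat.primesLE N with hP
  set V := ∑ p ∈ P, ‖b p‖ ^ 2 with hV
  set Q : ℝ → ℂ := fun t ↦ ∑ p ∈ P, b p * (p : ℂ) ^ (-((t : ℂ) * I)) with hQ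
  have hQc : Continuous Q := continuous_primeSum N b
  have hQi : Continuous fun t ↦ (Q t).im := Complex.continuous_im.comp hQc
  show 3 / 128 * T * Real.sqrt V ≤ ∫ t in T..2 * T, |(Q t).im|
  have hV0 : 0 ≤ V := Finset.sum_nonneg fun p _ ↦ sq_nonneg _
  have hT2 : T ≤ 2 * T := by linarith
  rcases hV0.eq_or_lt with hV00 | hVpos
  · rw [← hV00, Real.sqrt_zero, mul_zero]
    exact intervalIntegral.integral_nonneg hT2 fun t _ ↦ abs_nonneg _
  have hN0 : (0 : ℝ) ≤ N := Nat.cast_nonneg N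
  have hlogN : 0 ≤ 1 + Real.log N := by
    rcases Nat.eq_zero_or_pos N with h | h
    · rw [h]; simp
    · linarith [Real.log_nonneg (show (1 : ℝ) ≤ N by exact_mod_cast h)]
  have hlogN2 : 0 ≤ 1 + Real.log ((N : ℝ) ^ 2) := by
    rcases Nat.eq_zero_or_pos N with h | h
    · rw [h]; simp
    · have : (1 : ℝ) ≤ (N : ℝ) ^ 2 := one_le_pow₀ (by exact_mod_cast h)
      linarith [Real.log_nonneg this]
  -- integrability of the various integrands (all continuous)
  have hi_norm2 : IntervalIntegrable (fun t ↦ ‖Q t‖ ^ 2) volume T (2 * T) :=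
    (by fun_prop : Continuous fun t ↦ ‖Q t‖ ^ 2).intervalIntegrable _ _
  have hi_norm4 : IntervalIntegrable (fun t ↦ ‖Q t‖ ^ 4) volume T (2 * T) :=
    (by fun_prop : Continuous fun t ↦ ‖Q t‖ ^ 4).intervalIntegrable _ _
  have hi_sq : IntervalIntegrable (fun t ↦ (Q t) ^ 2) volume T (2 * T) :=
    (by fun_prop : Continuous fun t ↦ (Q t) ^ 2).intervalIntegrable _ _
  have hi_re : IntervalIntegrable (fun t ↦ ((Q t) ^ 2).re) volume T (2 * T) :=
    (by fun_prop : Continuous fun t ↦ ((Q t) ^ 2).re).intervalIntegrable _ _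
  have hi_im2 : IntervalIntegrable (fun t ↦ (Q t).im ^ 2) volume T (2 * T) :=
    (by fun_prop : Continuous fun t ↦ (Q t).im ^ 2).intervalIntegrable _ _
  have hi_im4 : IntervalIntegrable (fun t ↦ (Q t).im ^ 4) volume T (2 * T) :=
    (by fun_prop : Continuous fun t ↦ (Q t).im ^ 4).intervalIntegrable _ _
  have hi_abs : IntervalIntegrable (fun t ↦ |(Q t).im|) volume T (2 * T) :=
    (by fun_prop : Continuous fun t ↦ |(Q t).im|).intervalIntegrable _ _
  -- second moment of `Im Q` from below
  have hI2 : T * V / 4 ≤ ∫ t in T..2 * T, (Q t).im ^ 2 := by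
    have hid : ∀ t, (Q t).im ^ 2 = (‖Q t‖ ^ 2 - ((Q t) ^ 2).re) / 2 := by
      intro t
      rw [Complex.sq_norm, Complex.normSq_apply, sq (Q t), Complex.mul_re]
      ring
    simp_rw [hid]
    rw [intervalIntegral.integral_div, intervalIntegral.integral_sub hi_norm2 hi_re]
    have hre : ∫ t in T..2 * T, ((Q t) ^ 2).re = (∫ t in T..2 * T, (Q t) ^ 2).re := by
      have := intervalIntegral.intervalIntegral_re (μ := volume) hi_sq
      simpa using this
    have hms := abs_integral_norm_sq_primeSum_sub_le N b T
    have hsq := norm_integral_primeSum_sq_le N b T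
    have hre_le : (∫ t in T..2 * T, (Q t) ^ 2).re ≤ 3 * N * V := (Complex.re_le_norm _).trans hsq
    rw [abs_le] at hms
    rw [hre]
    have hkey : (16 * N * (1 + Real.log N) + 6 * N) * V ≤ T * V :=
      mul_le_mul_of_nonneg_right (by nlinarith) hV0
    nlinarith [hms.1]
  -- fourth moment of `Im Q` from above
  have hI4 : ∫ t in T..2 * T, (Q t).im ^ 4 ≤ 4 * T * V ^ 2 := by
    calc ∫ t in T..2 * T, (Q t).im ^ 4 ≤ ∫ t in T..2 * T, ‖Q t‖ ^ 4 := by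
          refine intervalIntegral.integral_mono_on hT2 hi_im4 hi_norm4 fun t _ ↦ ?_
          have h1 : |(Q t).im| ≤ ‖Q t‖ := Complex.abs_im_le_norm _
          calc (Q t).im ^ 4 = |(Q t).im| ^ 4 := by
                rw [show (4 : ℕ) = 2 * 2 from rfl, pow_mul, pow_mul, sq_abs]
            _ ≤ ‖Q t‖ ^ 4 := pow_le_pow_left₀ (abs_nonneg _) h1 4
      _ ≤ (T + 8 * N ^ 2 * (1 + Real.log (N ^ 2))) * (2 * V ^ 2) :=
          integral_norm_primeSum_pow_four_le N b hT
      _ ≤ (T + T) * (2 * V ^ 2) := by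
          refine mul_le_mul_of_nonneg_right ?_ (by positivity)
          nlinarith
      _ = 4 * T * V ^ 2 := by ring
  -- `|x| ≥ x²/K − x⁴/K³` with `K = 8 √V`
  set s := Real.sqrt V with hs
  have hspos : 0 < s := Real.sqrt_pos.2 hVpos
  have hsV : s ^ 2 = V := Real.sq_sqrt hV0
  set K := 8 * s with hK
  have hKpos : 0 < K := by positivity
  have hi_a : IntervalIntegrable (fun t ↦ (Q t).im ^ 2 / K) volume T (2 * T) :=
    (by fun_prop : Continuous fun t ↦ (Q t).im ^ 2 / K).intervalIntegrable _ _
  have hi_b : IntervalIntegrable (fun t ↦ (Q t).im ^ 4 / K ^ 3) volume T (2 * T) :=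
    (by fun_prop : Continuous fun t ↦ (Q t).im ^ 4 / K ^ 3).intervalIntegrable _ _
  have hmono := intervalIntegral.integral_mono_on hT2 (hi_a.sub hi_b) hi_abs
    fun t _ ↦ sq_div_sub_pow_four_div_le_abs (Q t).im hKpos
  rw [intervalIntegral.integral_sub hi_a hi_b, intervalIntegral.integral_div,
    intervalIntegral.integral_div] at hmono
  refine le_trans ?_ hmono
  calc 3 / 128 * T * s = T * V / 4 / K - 4 * T * V ^ 2 / K ^ 3 := by
        rw [hK, ← hsV]; field_simp; ring
    _ ≤ (∫ t in T..2 * T, (Q t).im ^ 2) / K - (∫ t in T..2 * T, (Q t).im ^ 4) / K ^ 3 :=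
        sub_le_sub (div_le_div_of_nonneg_right hI2 hKpos.le)
          (div_le_div_of_nonneg_right hI4 (by positivity))

/-! ### The coefficients `b_p = p^{-1/2} (p^{-ih} − 1)` of `P(t + h) − P(t)` -/

/-- `|e^{iθ} − 1|² = 2(1 − cos θ)`. [folklore] -/
theorem norm_sq_exp_mul_I_sub_one (θ : ℝ) :
    ‖cexp ((θ : ℂ) * I) - 1‖ ^ 2 = 2 * (1 - Real.cos θ) := by
  rw [Complex.sq_norm, Complex.normSq_apply]
  simp only [Complex.sub_re, Complex.sub_im, Complex.exp_ofReal_mul_I_re,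
    Complex.exp_ofReal_mul_I_im, Complex.one_re, Complex.one_im, sub_zero]
  nlinarith [Real.sin_sq_add_cos_sq θ]

/-- `|p^{-1/2}(p^{-ih} − 1)|² = 2(1 − cos(h log p))/p` for `p ≥ 1`. [folklore] -/
theorem norm_sq_coeff {p : ℕ} (hp : p ≠ 0) (h : ℝ) :
    ‖(Real.sqrt p : ℂ)⁻¹ * ((p : ℂ) ^ (-((h : ℂ) * I)) - 1)‖ ^ 2 =
      2 * (1 - Real.cos (h * Real.log p)) / p := by
  have hp0 : (0 : ℝ) < p := by exact_mod_cast Nat.pos_of_ne_zero hp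
  rw [natCast_cpow_neg_mul_I hp, norm_mul, mul_pow, norm_inv, Complex.norm_real,
    Real.norm_eq_abs, abs_of_nonneg (Real.sqrt_nonneg _), inv_pow, Real.sq_sqrt hp0.le,
    norm_sq_exp_mul_I_sub_one, Real.cos_neg]
  ring

/-- The imaginary part of `∑_p b_p p^{-it}` with `b_p = p^{-1/2}(p^{-ih} − 1)` is
`−(P(t + h) − P(t))`, `P(t) = ∑_{p ≤ N} sin(t log p)/√p`. [folklore] -/
theorem im_primeSum_coeff (N : ℕ) (h t : ℝ) :
    (∑ p ∈ Nat.primesLE N, (Real.sqrt p : ℂ)⁻¹ * ((p : ℂ) ^ (-((h : ℂ) * I)) - 1) *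
        (p : ℂ) ^ (-((t : ℂ) * I))).im =
      -∑ p ∈ Nat.primesLE N,
        (Real.sin ((t + h) * Real.log p) - Real.sin (t * Real.log p)) / Real.sqrt p := by
  rw [Complex.im_sum, ← Finset.sum_neg_distrib]
  refine Finset.sum_congr rfl fun p hp ↦ ?_
  have hp0 : p ≠ 0 := (Nat.mem_primesLE.1 hp).2.ne_zero
  rw [natCast_cpow_neg_mul_I hp0, natCast_cpow_neg_mul_I hp0, ← Complex.ofReal_inv, mul_assoc,
    Complex.im_ofReal_mul, sub_mul, one_mul, ← Complex.exp_add, Complex.sub_im]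
  have e : ((-(h * Real.log p) : ℝ) : ℂ) * I + ((-(t * Real.log p) : ℝ) : ℂ) * I =
      ((-((t + h) * Real.log p) : ℝ) : ℂ) * I := by push_cast; ring
  rw [e, Complex.exp_ofReal_mul_I_im, Complex.exp_ofReal_mul_I_im, Real.sin_neg, Real.sin_neg]
  rw [div_eq_inv_mul]
  ring

/-- With these coefficients `∑_p |b_p|² = ∑_{p ≤ N} 2(1 − cos(h log p))/p`. [folklore] -/
theorem sum_norm_sq_coeff (N : ℕ) (h : ℝ) :
    ∑ p ∈ Nat.primesLE N, ‖(Real.sqrt p : ℂ)⁻¹ * ((p : ℂ) ^ (-((h : ℂ) * I)) - 1)‖ ^ 2 =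
      ∑ p ∈ Nat.primesLE N, 2 * (1 - Real.cos (h * Real.log p)) / p :=
  Finset.sum_congr rfl fun _ hp ↦ norm_sq_coeff (Nat.mem_primesLE.1 hp).2.ne_zero h

/-! ### The variance `V(h, N) = ∑_{p ≤ N} 2(1 − cos(h log p))/p`: upper bound -/

/-- `0 ≤ 2(1 − cos u)/p`. [folklore] -/
theorem two_mul_one_sub_cos_div_nonneg (u : ℝ) (p : ℕ) : 0 ≤ 2 * (1 - Real.cos u) / p :=
  div_nonneg (mul_nonneg zero_le_two (sub_nonneg.2 (Real.cos_le_one u))) p.cast_nonneg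

open Literature.NumberTheory.LFunctions.Mertens in
/-- **Upper bound for the variance.** For `0 ≤ h ≤ 1` and `N ≥ 2`:
`∑_{p ≤ N} 2(1 − cos(h log p))/p ≤ 4 log(2 + h log N) + 70`.
Proof: for `p ≤ e^{1/h}`, `1 − cos(h log p) ≤ h² log² p/2 ≤ (h/2) log p` and Mertens' first
theorem gives `≤ h(1/h + 2) ≤ 3`; for `e^{1/h} < p ≤ N` the terms are `≤ 4/p` and Mertens' second
theorem (`abs_primeRecipSum_sub_le`, error `8/log`) gives
`≤ 4(log log N − log(1/h)) + 64 h`. [cite: Titchmarsh1986, §14.23; HardyWright2008, Thms 425, 427] -/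
theorem variance_le {h : ℝ} (hh : 0 ≤ h) (hh1 : h ≤ 1) {N : ℕ} (hN : 2 ≤ N) :
    ∑ p ∈ Nat.primesLE N, 2 * (1 - Real.cos (h * Real.log p)) / p ≤
      4 * Real.log (2 + h * Real.log N) + 70 := by
  have hN0 : (0 : ℝ) < N := by exact_mod_cast (by omega : 0 < N)
  have hN2 : (2 : ℝ) ≤ N := by exact_mod_cast hN
  have hlogN : 0 < Real.log N := Real.log_pos (by linarith)
  have hlog2 : 0 < Real.log (2 + h * Real.log N) :=
    Real.log_pos (by nlinarith)
  rcases hh.eq_or_lt with h0 | hpos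
  · -- `h = 0`: the sum vanishes
    rw [← h0]
    have := Real.log_two_gt_d9
    simp only [zero_mul, Real.cos_zero, sub_self, mul_zero, zero_div, Finset.sum_const_zero,
      add_zero]
    positivity
  set f : ℕ → ℝ := fun p ↦ 2 * (1 - Real.cos (h * Real.log p)) / p with hf
  have hf0 : ∀ p, 0 ≤ f p := fun p ↦ two_mul_one_sub_cos_div_nonneg _ _
  set y : ℝ := Real.exp (1 / h) with hy
  have hy1 : Real.log y = 1 / h := Real.log_exp _
  have hye : Real.exp 1 ≤ y := Real.exp_le_exp.2 (by rw [le_div_iff₀ hpos]; linarith)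
  have hy2 : 2 ≤ y := le_trans (by have := Real.exp_one_gt_d9; linarith) hye
  -- split at `y`
  rw [← Finset.sum_filter_add_sum_filter_not (Nat.primesLE N) (fun p : ℕ ↦ (p : ℝ) ≤ y)]
  -- Part A: `p ≤ y`
  have hA : ∑ p ∈ (Nat.primesLE N).filter (fun p : ℕ ↦ (p : ℝ) ≤ y), f p ≤ 3 := by
    have hsub : (Nat.primesLE N).filter (fun p : ℕ ↦ (p : ℝ) ≤ y) ⊆ Nat.primesLE ⌊y⌋₊ := by
      intro p hp
      rw [Finset.mem_filter, Nat.mem_primesLE] at hp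
      rw [Nat.mem_primesLE]
      exact ⟨Nat.le_floor hp.2, hp.1.2⟩
    have hterm : ∀ p ∈ Nat.primesLE ⌊y⌋₊, f p ≤ h * (Real.log p / p) := by
      intro p hp
      rw [Nat.mem_primesLE] at hp
      have hp0 : (0 : ℝ) < p := by exact_mod_cast hp.2.pos
      have hp1 : (1 : ℝ) ≤ p := by exact_mod_cast hp.2.one_le
      have hpy : (p : ℝ) ≤ y := (Nat.le_floor_iff (by positivity)).1 hp.1
      have hlogp : 0 ≤ Real.log p := Real.log_nonneg hp1
      have hlogpy : Real.log p ≤ 1 / h := by rw [← hy1]; exact Real.log_le_log hp0 hpy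
      have hcos := Real.one_sub_sq_div_two_le_cos (x := h * Real.log p)
      rw [hf]
      simp only
      rw [div_le_iff₀ hp0, mul_assoc, div_mul_cancel₀ _ hp0.ne']
      -- `2(1 − cos(h log p)) ≤ (h log p)² ≤ h log p`
      have h1 : (h * Real.log p) ^ 2 ≤ h * Real.log p := by
        have : h * Real.log p ≤ 1 := by
          calc h * Real.log p ≤ h * (1 / h) := mul_le_mul_of_nonneg_left hlogpy hh
            _ = 1 := by field_simp
        nlinarith [mul_nonneg hh hlogp]
      nlinarith
    have hM := (MertensBound.sum_log_div_prime_bounds (t := y) (by linarith)).2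
    calc ∑ p ∈ (Nat.primesLE N).filter (fun p : ℕ ↦ (p : ℝ) ≤ y), f p
        ≤ ∑ p ∈ Nat.primesLE ⌊y⌋₊, f p := Finset.sum_le_sum_of_subset_of_nonneg hsub fun p _ _ ↦ hf0 p
      _ ≤ ∑ p ∈ Nat.primesLE ⌊y⌋₊, h * (Real.log p / p) := Finset.sum_le_sum hterm
      _ = h * ∑ p ∈ Nat.primesLE ⌊y⌋₊, Real.log p / p := (Finset.mul_sum _ _ _).symm
      _ ≤ h * (Real.log y + 2) := mul_le_mul_of_nonneg_left hM hh
      _ = 1 + 2 * h := by rw [hy1]; field_simp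
      _ ≤ 3 := by linarith
  -- Part B: `y < p ≤ N`
  have hB : ∑ p ∈ (Nat.primesLE N).filter (fun p : ℕ ↦ ¬ (p : ℝ) ≤ y), f p ≤
      4 * Real.log (2 + h * Real.log N) + 64 := by
    rcases le_or_gt y N with hyN | hyN
    · -- the window `(y, N]`
      have hwin : (Nat.primesLE N).filter (fun p : ℕ ↦ ¬ (p : ℝ) ≤ y) =
          (Nat.primesLE ⌊(N : ℝ)⌋₊).filter (fun p : ℕ ↦ y < (p : ℝ)) := by
        rw [Nat.floor_natCast]
        exact Finset.filter_congr fun p _ ↦ not_le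
      rw [hwin]
      have hterm : ∀ p ∈ (Nat.primesLE ⌊(N : ℝ)⌋₊).filter (fun p : ℕ ↦ y < (p : ℝ)),
          f p ≤ 4 * (p : ℝ)⁻¹ := by
        intro p hp
        rw [Finset.mem_filter, Nat.mem_primesLE] at hp
        have hp0 : (0 : ℝ) < p := by exact_mod_cast hp.1.2.pos
        rw [hf]
        simp only
        rw [div_le_iff₀ hp0, mul_assoc, inv_mul_cancel₀ hp0.ne', mul_one]
        nlinarith [Real.neg_one_le_cos (h * Real.log p)]
      have hM := sum_primesLE_filter_lt_eq_sub (fun p : ℕ ↦ (p : ℝ)⁻¹) (by linarith) hyN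
      have hMN := abs_primeRecipSum_sub_le (x := N) hN2
      have hMy := abs_primeRecipSum_sub_le (x := y) hy2
      rw [primeRecipSum] at hMN hMy
      rw [abs_le] at hMN hMy
      have hlogy : Real.log (Real.log y) = -Real.log h := by
        rw [hy1, one_div, Real.log_inv]
      have hlogNy : 8 / Real.log N ≤ 8 * h := by
        rw [div_le_iff₀ hlogN]
        have : 1 / h ≤ Real.log N := by
          rw [← hy1]; exact Real.log_le_log (by linarith) hyN
        have := mul_le_mul_of_nonneg_left this hh
        rw [mul_one_div_cancel hpos.ne'] at this
        linarith
      have hlogy' : 8 / Real.log y = 8 * h := by rw [hy1]; field_simp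
      have hhl : 1 ≤ h * Real.log N := by
        have : 1 / h ≤ Real.log N := by
          rw [← hy1]; exact Real.log_le_log (by linarith) hyN
        have := mul_le_mul_of_nonneg_left this hh
        rwa [mul_one_div_cancel hpos.ne'] at this
      -- `log log N + log h = log(h log N) ≤ log(2 + h log N)`
      have hll : Real.log (Real.log N) - (-Real.log h) ≤ Real.log (2 + h * Real.log N) := by
        rw [sub_neg_eq_add, ← Real.log_mul hlogN.ne' hpos.ne']
        exact Real.log_le_log (by positivity) (by linarith)
      calc ∑ p ∈ (Nat.primesLE ⌊(N : ℝ)⌋₊).filter (fun p : ℕ ↦ y < (p : ℝ)), f p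
          ≤ ∑ p ∈ (Nat.primesLE ⌊(N : ℝ)⌋₊).filter (fun p : ℕ ↦ y < (p : ℝ)), 4 * (p : ℝ)⁻¹ :=
            Finset.sum_le_sum hterm
        _ = 4 * ((∑ p ∈ Nat.primesLE ⌊(N : ℝ)⌋₊, (p : ℝ)⁻¹) - ∑ p ∈ Nat.primesLE ⌊y⌋₊, (p : ℝ)⁻¹) := by
            rw [← Finset.mul_sum, hM]
        _ ≤ 4 * Real.log (2 + h * Real.log N) + 64 := by
            nlinarith [hMN.2, hMy.1]
    · -- no primes above `N`
      have hempty : (Nat.primesLE N).filter (fun p : ℕ ↦ ¬ (p : ℝ) ≤ y) = ∅ := by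
        refine Finset.filter_eq_empty_iff.2 fun p hp hpy ↦ hpy ?_
        rw [Nat.mem_primesLE] at hp
        exact le_trans (by exact_mod_cast hp.1) hyN.le
      rw [hempty, Finset.sum_empty]
      positivity
  linarith

/-! ### The variance: lower bound -/

/-- `cos θ ≤ −1/2` for `2πk + 2π/3 ≤ θ ≤ 2πk + 4π/3` (`k ∈ ℕ`). [folklore] -/
theorem cos_le_neg_half {θ : ℝ} {k : ℕ} (h1 : 2 * π * k + 2 * π / 3 ≤ θ)
    (h2 : θ ≤ 2 * π * k + 4 * π / 3) : Real.cos θ ≤ -1 / 2 := by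
  have hπ := Real.pi_pos
  set δ := θ - k * (2 * π) - π with hδ
  have hθ : θ = (δ + π) + k * (2 * π) := by rw [hδ]; ring
  have hcos : Real.cos θ = -Real.cos δ := by
    rw [hθ, Real.cos_add_nat_mul_two_pi, Real.cos_add_pi]
  have hδabs : |δ| ≤ π / 3 := by
    rw [abs_le, hδ]; constructor <;> linarith
  have hc : Real.cos (π / 3) ≤ Real.cos δ := by
    rw [← Real.cos_abs δ]
    exact Real.cos_le_cos_of_nonneg_of_le_pi (abs_nonneg _) (by linarith) hδabs
  rw [Real.cos_pi_div_three] at hc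
  linarith

/-- The variance is monotone in the length. [folklore] -/
theorem variance_mono (h : ℝ) {x x' : ℝ} (hxx' : x ≤ x') :
    ∑ p ∈ Nat.primesLE ⌊x⌋₊, 2 * (1 - Real.cos (h * Real.log p)) / p ≤
      ∑ p ∈ Nat.primesLE ⌊x'⌋₊, 2 * (1 - Real.cos (h * Real.log p)) / p :=
  Finset.sum_le_sum_of_subset_of_nonneg (fun p hp ↦ by
    rw [Nat.mem_primesLE] at hp ⊢
    exact ⟨hp.1.trans (Nat.floor_mono hxx'), hp.2⟩) fun _ _ _ ↦ two_mul_one_sub_cos_div_nonneg _ _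

/-- `∑_{m < M} 1/(m + 2) ≥ log(M + 2) − log 2` (telescoping `log(m+3) − log(m+2) ≤ 1/(m+2)`).
[folklore] -/
theorem log_sub_log_le_sum_range_inv (M : ℕ) :
    Real.log (M + 2) - Real.log 2 ≤ ∑ m ∈ Finset.range M, 1 / ((m : ℝ) + 2) := by
  have htel : ∑ m ∈ Finset.range M, (Real.log ((m : ℝ) + 1 + 2) - Real.log ((m : ℝ) + 2)) =
      Real.log (M + 2) - Real.log 2 := by
    have := Finset.sum_range_sub (fun m : ℕ ↦ Real.log ((m : ℝ) + 2)) M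
    simp only [Nat.cast_add, Nat.cast_one] at this
    rw [this]; norm_num
  rw [← htel]
  refine Finset.sum_le_sum fun m _ ↦ ?_
  have hm : (0 : ℝ) < (m : ℝ) + 2 := by positivity
  rw [← Real.log_div (by positivity) hm.ne']
  have := Real.log_le_sub_one_of_pos (show (0 : ℝ) < ((m : ℝ) + 1 + 2) / ((m : ℝ) + 2) by positivity)
  have e : ((m : ℝ) + 1 + 2) / ((m : ℝ) + 2) - 1 = 1 / ((m : ℝ) + 2) := by field_simp; ring
  linarith

set_option maxHeartbeats 400000 in
open Literature.NumberTheory.LFunctions.Mertens in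
/-- **One window.** On the primes `p` with `2π(m+1) + 2π/3 < h log p ≤ 2π(m+1) + 4π/3` one has
`cos(h log p) ≤ −1/2`, so `2(1 − cos(h log p))/p ≥ 3/p`, and Mertens' second theorem with error
`K/log²` gives `∑_window 1/p ≥ 1/(3m + 5) − K/(19 (m+1)²)`; hence the window contributes at least
`1/(m + 2) − K/(6 (m+1)²)` to the variance (`0 < h ≤ 1`). [cite: MontgomeryVaughan2007, Thm 2.7 (d)] -/
theorem window_lower_bound {h K : ℝ} (hh : 0 < h) (hh1 : h ≤ 1) (hK0 : 0 ≤ K)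
    (hK : ∀ x : ℝ, 2 ≤ x →
      |primeRecipSum x - Real.log (Real.log x) - meisselMertens| ≤ K / Real.log x ^ 2)
    (m : ℕ) :
    1 / ((m : ℝ) + 2) - K / (6 * ((m : ℝ) + 1) ^ 2) ≤
      (∑ p ∈ Nat.primesLE ⌊Real.exp ((2 * π * (m + 1) + 4 * π / 3) / h)⌋₊,
          2 * (1 - Real.cos (h * Real.log p)) / p) -
        ∑ p ∈ Nat.primesLE ⌊Real.exp ((2 * π * (m + 1) + 2 * π / 3) / h)⌋₊,
          2 * (1 - Real.cos (h * Real.log p)) / p := by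
  have hπ : 3 < π := Real.pi_gt_three
  have hm0 : (0 : ℝ) ≤ m := Nat.cast_nonneg m
  set A : ℝ := 2 * π * (m + 1) + 2 * π / 3 with hA
  set B : ℝ := 2 * π * (m + 1) + 4 * π / 3 with hB
  have hA0 : 0 < A := by positivity
  have hAB : A ≤ B := by rw [hA, hB]; linarith
  have hB0 : 0 < B := by linarith
  set u : ℝ := Real.exp (A / h) with hu
  set w : ℝ := Real.exp (B / h) with hw
  have hu0 : 0 ≤ u := (Real.exp_pos _).le
  have huw : u ≤ w := Real.exp_le_exp.2 (div_le_div_of_nonneg_right hAB hh.le)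
  have hlogu : Real.log u = A / h := Real.log_exp _
  have hlogw : Real.log w = B / h := Real.log_exp _
  have hAh : A ≤ A / h := by
    rw [le_div_iff₀ hh]; nlinarith
  have hBh : B ≤ B / h := by
    rw [le_div_iff₀ hh]; nlinarith
  have hu2 : 2 ≤ u := by
    have h1 : (1 : ℝ) ≤ A / h := le_trans (by rw [hA]; nlinarith) hAh
    have := Real.exp_one_gt_d9
    calc (2 : ℝ) ≤ Real.exp 1 := by linarith
      _ ≤ u := Real.exp_le_exp.2 h1
  have hw2 : 2 ≤ w := hu2.trans huw
  -- Step 1: the window sum of `2(1 − cos)/p` dominates `3 ∑_window 1/p`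
  have hstep1 : 3 * (primeRecipSum w - primeRecipSum u) ≤
      (∑ p ∈ Nat.primesLE ⌊w⌋₊, 2 * (1 - Real.cos (h * Real.log p)) / p) -
        ∑ p ∈ Nat.primesLE ⌊u⌋₊, 2 * (1 - Real.cos (h * Real.log p)) / p := by
    rw [primeRecipSum, primeRecipSum, ← sum_primesLE_filter_lt_eq_sub _ hu0 huw,
      ← sum_primesLE_filter_lt_eq_sub _ hu0 huw, Finset.mul_sum]
    refine Finset.sum_le_sum fun p hp ↦ ?_
    rw [Finset.mem_filter, Nat.mem_primesLE] at hp
    obtain ⟨⟨hpw, hpp⟩, hup⟩ := hp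
    have hp0 : (0 : ℝ) < p := by exact_mod_cast hpp.pos
    have hpw' : (p : ℝ) ≤ w := (Nat.le_floor_iff (hu0.trans huw)).1 hpw
    have hlogp1 : A / h < Real.log p := by
      rw [← hlogu]; exact Real.log_lt_log (Real.exp_pos _) hup
    have hlogp2 : Real.log p ≤ B / h := by
      rw [← hlogw]; exact Real.log_le_log hp0 hpw'
    have hθ1 : 2 * π * ↑(m + 1) + 2 * π / 3 ≤ h * Real.log p := by
      have := (div_lt_iff₀ hh).1 hlogp1
      push_cast
      rw [hA] at this; linarith
    have hθ2 : h * Real.log p ≤ 2 * π * ↑(m + 1) + 4 * π / 3 := by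
      have := (le_div_iff₀ hh).1 hlogp2
      push_cast
      rw [hB] at this; linarith
    have hcos := cos_le_neg_half hθ1 hθ2
    rw [div_eq_mul_inv _ (p : ℝ)]
    exact mul_le_mul_of_nonneg_right (by linarith) (inv_nonneg.2 hp0.le)
  -- Step 2: Mertens on the window
  have hstep2 : 1 / (3 * (m : ℝ) + 5) - K / (19 * ((m : ℝ) + 1) ^ 2) ≤
      primeRecipSum w - primeRecipSum u := by
    have hMw := hK w hw2
    have hMu := hK u hu2
    rw [hlogw] at hMw
    rw [hlogu] at hMu
    rw [abs_le] at hMw hMu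
    -- main term
    have hmain : 1 / (3 * (m : ℝ) + 5) ≤ Real.log (B / h) - Real.log (A / h) := by
      rw [← Real.log_div (by positivity) (by positivity), div_div_div_cancel_right₀ hh.ne']
      have := Real.one_sub_inv_le_log_of_pos (show 0 < B / A by positivity)
      rw [inv_div] at this
      have e : 1 - A / B = 1 / (3 * (m : ℝ) + 5) := by
        rw [hA, hB]; field_simp; ring
      linarith
    -- error terms
    have herr : K / (A / h) ^ 2 + K / (B / h) ^ 2 ≤ K / (19 * ((m : ℝ) + 1) ^ 2) := by
      have hπ2 : (19 : ℝ) ≤ 2 * π ^ 2 := by nlinarith [Real.pi_gt_d2]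
      have h19 : 19 * ((m : ℝ) + 1) ^ 2 ≤ (2 * π * (m + 1)) ^ 2 / 2 := by
        have := mul_le_mul_of_nonneg_right hπ2 (sq_nonneg ((m : ℝ) + 1))
        nlinarith
      have hA' : (2 * π * ((m : ℝ) + 1)) ^ 2 ≤ (A / h) ^ 2 := by
        apply pow_le_pow_left₀ (by positivity)
        exact le_trans (by rw [hA]; linarith) hAh
      have hB' : (2 * π * ((m : ℝ) + 1)) ^ 2 ≤ (B / h) ^ 2 := by
        apply pow_le_pow_left₀ (by positivity)
        exact le_trans (by rw [hB]; linarith) hBh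
      have hpos : (0 : ℝ) < (2 * π * (m + 1)) ^ 2 := by positivity
      calc K / (A / h) ^ 2 + K / (B / h) ^ 2
          ≤ K / (2 * π * ((m : ℝ) + 1)) ^ 2 + K / (2 * π * ((m : ℝ) + 1)) ^ 2 :=
            add_le_add (div_le_div_of_nonneg_left hK0 hpos hA')
              (div_le_div_of_nonneg_left hK0 hpos hB')
        _ = K / ((2 * π * ((m : ℝ) + 1)) ^ 2 / 2) := by field_simp; ring
        _ ≤ K / (19 * ((m : ℝ) + 1) ^ 2) := div_le_div_of_nonneg_left hK0 (by positivity) h19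
    linarith [hMw.1, hMu.2]
  -- combine
  have h3 : 1 / ((m : ℝ) + 2) ≤ 3 * (1 / (3 * (m : ℝ) + 5)) := by
    rw [mul_one_div, div_le_div_iff₀ (by positivity) (by positivity)]; nlinarith
  have h4 : 3 * (K / (19 * ((m : ℝ) + 1) ^ 2)) ≤ K / (6 * ((m : ℝ) + 1) ^ 2) := by
    rw [mul_div_assoc', div_le_div_iff₀ (by positivity) (by positivity)]
    nlinarith [sq_nonneg ((m : ℝ) + 1), mul_nonneg hK0 (sq_nonneg ((m : ℝ) + 1))]
  linarith

open Literature.NumberTheory.LFunctions.Mertens in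
/-- **Lower bound for the variance (qualitative form).** For every `V₀` there is `L₀` such that
`∑_{p ≤ N} 2(1 − cos(h log p))/p ≥ V₀` whenever `0 < h ≤ 1` and `h log N ≥ L₀`: sum the windows
`m < M` of `window_lower_bound` (`∑_{m<M} 1/(m+2) ≥ log(M+2) − log 2`, `∑ 1/(m+1)² ≤ 2`), which
fit below `N` as soon as `h log N ≥ 2π(M + 1)`. (Quantitatively the variance is
`≍ log(h log N)`; only its divergence is needed.) [cite: Titchmarsh1986, §14.23] -/
theorem variance_ge (V₀ : ℝ) : ∃ L₀ : ℝ, ∀ h : ℝ, 0 < h → h ≤ 1 → ∀ N : ℕ,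
    L₀ ≤ h * Real.log N →
      V₀ ≤ ∑ p ∈ Nat.primesLE N, 2 * (1 - Real.cos (h * Real.log p)) / p := by
  obtain ⟨K₀, hK₀⟩ := abs_primeRecipSum_sub_loglog_sub_le 2
  set K := max K₀ 0 with hKdef
  have hK0 : 0 ≤ K := le_max_right _ _
  have hK : ∀ x : ℝ, 2 ≤ x →
      |primeRecipSum x - Real.log (Real.log x) - meisselMertens| ≤ K / Real.log x ^ 2 :=
    fun x hx ↦ (hK₀ x hx).trans (div_le_div_of_nonneg_right (le_max_left _ _) (sq_nonneg _))
  have hπ : 3 < π := Real.pi_gt_three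
  obtain ⟨M, hM⟩ : ∃ M : ℕ, V₀ + 1 + K ≤ Real.log ((M : ℝ) + 2) := by
    obtain ⟨M, hM⟩ := exists_nat_ge (Real.exp (V₀ + 1 + K))
    refine ⟨M, ?_⟩
    rw [← Real.log_exp (V₀ + 1 + K)]
    exact Real.log_le_log (Real.exp_pos _) (by linarith)
  refine ⟨2 * π * (M + 1), fun h hh hh1 N hL ↦ ?_⟩
  -- the tops of the windows
  set wtop : ℕ → ℝ := fun M' ↦ Real.exp ((2 * π * M' + 4 * π / 3) / h) with hwtop
  set F : ℝ → ℝ := fun x ↦ ∑ p ∈ Nat.primesLE ⌊x⌋₊, 2 * (1 - Real.cos (h * Real.log p)) / p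
    with hF
  have hF0 : ∀ x, 0 ≤ F x := fun x ↦ Finset.sum_nonneg fun p _ ↦ two_mul_one_sub_cos_div_nonneg _ _
  have hFmono : ∀ x x', x ≤ x' → F x ≤ F x' := fun x x' hxx' ↦ variance_mono h hxx'
  -- peeling off the windows one by one
  have hpeel : ∀ M' : ℕ, ∑ m ∈ Finset.range M',
      (F (Real.exp ((2 * π * (m + 1) + 4 * π / 3) / h)) -
        F (Real.exp ((2 * π * (m + 1) + 2 * π / 3) / h))) ≤ F (wtop M') := by
    intro M'
    induction M' with
    | zero => simpa using hF0 _
    | succ M' ih =>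
      rw [Finset.sum_range_succ]
      have h1 : F (wtop M') ≤ F (Real.exp ((2 * π * (M' + 1) + 2 * π / 3) / h)) := by
        refine hFmono _ _ (Real.exp_le_exp.2 (div_le_div_of_nonneg_right ?_ hh.le))
        linarith
      have h2 : F (Real.exp ((2 * π * (M' + 1) + 4 * π / 3) / h)) = F (wtop (M' + 1)) := by
        simp only [hwtop]; push_cast; ring_nf
      linarith
  -- the windows fit below `N`
  have hlogN : (2 * π * M + 4 * π / 3) / h ≤ Real.log N := by
    rw [div_le_iff₀ hh]; linarith
  have hN1 : (1 : ℝ) < N := by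
    have hpos : 0 < Real.log N := by
      have h1 : 0 < 2 * π * ((M : ℝ) + 1) := by positivity
      exact (mul_pos_iff_of_pos_left hh).1 (lt_of_lt_of_le h1 hL)
    by_contra hle
    rw [not_lt] at hle
    have := Real.log_nonpos (Nat.cast_nonneg N) hle
    linarith
  have hfit : wtop M ≤ N := by
    calc wtop M = Real.exp ((2 * π * M + 4 * π / 3) / h) := rfl
      _ ≤ Real.exp (Real.log N) := Real.exp_le_exp.2 hlogN
      _ = N := Real.exp_log (by linarith)
  -- assemble
  have hwin : ∀ m ∈ Finset.range M, 1 / ((m : ℝ) + 2) - K / (6 * ((m : ℝ) + 1) ^ 2) ≤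
      F (Real.exp ((2 * π * (m + 1) + 4 * π / 3) / h)) -
        F (Real.exp ((2 * π * (m + 1) + 2 * π / 3) / h)) :=
    fun m _ ↦ window_lower_bound hh hh1 hK0 hK m
  have hsum := Finset.sum_le_sum hwin
  rw [Finset.sum_sub_distrib] at hsum
  have ha := log_sub_log_le_sum_range_inv M
  have hb : ∑ m ∈ Finset.range M, K / (6 * ((m : ℝ) + 1) ^ 2) ≤ K / 3 := by
    -- `∑_{m < M} 1/(m+1)² ≤ 2`
    have hsq : ∀ M : ℕ, ∑ m ∈ Finset.range (M + 1), 1 / ((m : ℝ) + 1) ^ 2 ≤ 2 - 1 / ((M : ℝ) + 1) := by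
      intro M
      induction M with
      | zero => norm_num
      | succ M ih =>
        rw [Finset.sum_range_succ]
        push_cast
        have hM : (0 : ℝ) ≤ M := Nat.cast_nonneg M
        have hkey : 1 / ((M : ℝ) + 1 + 1) ^ 2 + 1 / ((M : ℝ) + 1 + 1) ≤ 1 / ((M : ℝ) + 1) := by
          rw [div_add_div _ _ (by positivity) (by positivity),
            div_le_div_iff₀ (by positivity) (by positivity)]
          nlinarith
        linarith
    have this : ∑ m ∈ Finset.range M, 1 / ((m : ℝ) + 1) ^ 2 ≤ 2 :=
      calc ∑ m ∈ Finset.range M, 1 / ((m : ℝ) + 1) ^ 2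
          ≤ ∑ m ∈ Finset.range (M + 1), 1 / ((m : ℝ) + 1) ^ 2 :=
            Finset.sum_le_sum_of_subset_of_nonneg (Finset.range_subset_range.2 (Nat.le_succ M))
              fun m _ _ ↦ by positivity
        _ ≤ 2 - 1 / ((M : ℝ) + 1) := hsq M
        _ ≤ 2 := by
            have : 0 ≤ 1 / ((M : ℝ) + 1) := by positivity
            linarith
    calc ∑ m ∈ Finset.range M, K / (6 * ((m : ℝ) + 1) ^ 2)
        = K / 6 * ∑ m ∈ Finset.range M, 1 / ((m : ℝ) + 1) ^ 2 := by
          rw [Finset.mul_sum]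
          refine Finset.sum_congr rfl fun m _ ↦ ?_
          field_simp
      _ ≤ K / 6 * 2 := mul_le_mul_of_nonneg_left this (by positivity)
      _ = K / 3 := by ring
  have hlog2 : Real.log 2 < 1 := by have := Real.log_two_lt_d9; linarith
  have hFN : F (wtop M) ≤ ∑ p ∈ Nat.primesLE N, 2 * (1 - Real.cos (h * Real.log p)) / p := by
    have := hFmono _ _ hfit
    simp only [hF, Nat.floor_natCast] at this ⊢
    exact this
  linarith [hpeel M]

end SelbergFujii

end Literature.NumberTheory.LFunctions

end
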